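/-
Copyright: pub-rosobs cell (Resolution Observatory), carver gen 49.  Companion file; statements OURS — the σ ↦ −σ
sigmaNeg of an isotropy and the congruences of `Γ_σ := Φ_σ ∘ Φ_{−σ}` used in the cell's LEMMA Γ / BOOTSTRAP LEMMA (engine 1
gen 33, THEOREM-LC §6 (2); CARVER-NOTES-eng1-g33 T12 input (ii), identity part), in the model `A₀[X]` (`X = σ`,
`A₀ = k[ε_N]`).  Instrument — NOT a resolution theorem, NOT a statement about the invariant of
[AbramovichTemkinWlodarczyk2024], NOT summit progress.
-/
import Mathlib.Algebra.Polynomial.AlgebraMap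
import Mathlib.RingTheory.Ideal.Span
import Mathlib.RingTheory.Ideal.Maps
import Mathlib.RingTheory.PolynomialAlgebra
import HarnessLib

/-!
# The sigmaNeg `σ ↦ −σ` and the congruences of `Γ_σ = Φ_σ ∘ Φ_{−σ}`

Model: `A₀` a commutative ring (in the cell `A₀ = k[ε_N]`), `A₀[X]` with `X = σ`; an "isotropy" is a ring endomorphism
`Φ` of `A₀[X]` with `Φ X = X` (it is `k[σ]`-linear) and `Φ ≡ id (mod X)` on constants.  The sigmaNeg `τ : X ↦ −X` is the
`A₀`-algebra involution `sigmaNeg`, and `Φ_{−σ} := τ ∘ Φ ∘ τ = twistConj Φ`.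

* `sub_mem_of_forall_C` : two ring maps out of `A₀[X]` are congruent modulo an ideal as soon as they are on `X` and on
  the constants `C a` (the set where they agree mod `I` is a subring);
* `sigmaNeg_sigmaNeg`, `sigmaNeg_sub_self_mem`, `sigmaNeg_mem_span_X_pow` : `τ² = id`, `τ ≡ id (mod X)`, `τ` preserves `(Xⁿ)`;
* `twistConj_twistConj`, `twistConj_comp` : `Φ ↦ Φ_{−σ}` is an involutive monoid endomorphism; `IsIsotropyOf`:
  `Φ(g) = g` for `g ∈ A₀` is preserved by composition and by the sigmaNeg (the group-law part of T12 (ii) at identity level);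
* **`gammaOf_sub_self_mem`** (LEMMA Γ (b)): `Φ X = X`, `Φ ≡ id (mod X)` ⇒ `Γ_σ := Φ ∘ Φ_{−σ} ≡ id (mod X²)`;
* **`twistConj_sub_mem_span_pow_succ`** (parity): `Γ X = X`, `Γ ≡ id (mod Xⁿ)`, `n` even ⇒ `Γ_{−σ} ≡ Γ_σ (mod Xⁿ⁺¹)`;
  hence `twistConj_gammaOf_sub_gammaOf_mem` : `Γ_{−σ} ≡ Γ_σ (mod X³)`, and `twistConj_gammaOf = Φ_{−σ} ∘ Φ_σ`;
* over a base ring `k` (`[Algebra k A₀]`, local instance `Polynomial.algebra : Algebra k[X] A₀[X]`): `toPolyAlgHom`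
  upgrades a ring endomorphism fixing `X` and the constants of `k` to a `k[X]`-algebra endomorphism, and
  `gammaOf_sub_self_mem_map`, `twistConj_gammaOf_sub_self_mem_map`, `twistConj_gammaOf_sub_gammaOf_mem_map` restate
  the three congruences with the ideals `((Xⁿ) ⊆ k[X]).map (algebraMap k[X] A₀[X])` — exactly the hypotheses `hΓ`, `hΓ'`,
  `hd` of `iterate_pred_char_comp_sub_self_mem_span_cube` / `iterate_char_sub_self_mem_span_cube` of the companion file
  `WeightedCentreUnipotentIsotropy` (LEMMA Γ (c): `Γ_σ^p ≡ id`, `Γ_σ^{p−1} ∘ Γ_{−σ} ≡ id (mod σ³)` in characteristic `p`).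

The binomial / conjugation bookkeeping is classical [cite: SerreLocalFields1979, Ch. II §4 Lemma 1] (congruence level of a
p-th power; here: of a product with the conjugate); NOT typed here: gradings (deg σ = ρ, weights of ε) and the pure part
`2cσ²` of `Γ_σ(ε_a)` (LEMMA Γ (a)), which need the weighted set-up.  Formalisation ours.
-/

namespace Literature.AlgebraicGeometry.Resolution.WeightedBlowup

open Polynomial

variable {A₀ : Type*} [CommRing A₀]

/-! ## Congruence of ring maps out of `A₀[X]` is decided on generators -/

section Generators

variable {B : Type*} [CommRing B]

/-- Two ring maps `Γ, Γ' : A₀[X] → B` with `Γ X ≡ Γ' X` and `Γ (C a) ≡ Γ' (C a) (mod I)` are congruent `mod I`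
everywhere (derived here; `{f | Γ f − Γ' f ∈ I}` is a subring). [cite: SerreLocalFields1979, Ch. II §4 Lemma 1] -/
theorem sub_mem_of_forall_C {Γ Γ' : A₀[X] →+* B} (I : Ideal B) (hX : Γ X - Γ' X ∈ I)
    (hC : ∀ a, Γ (C a) - Γ' (C a) ∈ I) (f : A₀[X]) : Γ f - Γ' f ∈ I := by
  refine Polynomial.induction_on' f ?_ ?_
  · intro p q hp hq
    have : Γ (p + q) - Γ' (p + q) = (Γ p - Γ' p) + (Γ q - Γ' q) := by rw [map_add, map_add]; abel
    rw [this]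
    exact add_mem hp hq
  · intro n a
    induction n with
    | zero => simpa using hC a
    | succ n ih =>
      rw [← monomial_mul_X, map_mul, map_mul]
      have : Γ (monomial n a) * Γ X - Γ' (monomial n a) * Γ' X
          = Γ (monomial n a) * (Γ X - Γ' X) + (Γ (monomial n a) - Γ' (monomial n a)) * Γ' X := by ring
      rw [this]
      exact add_mem (I.mul_mem_left _ hX) (I.mul_mem_right _ ih)

/-- `Γ ≡ id (mod I)` on `A₀[X]` as soon as `Γ X ≡ X` and `Γ (C a) ≡ C a` (derived here).
[cite: SerreLocalFields1979, Ch. II §4 Lemma 1] -/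
theorem sub_self_mem_of_forall_C (Γ : A₀[X] →+* A₀[X]) (I : Ideal A₀[X]) (hX : Γ X - X ∈ I)
    (hC : ∀ a, Γ (C a) - C a ∈ I) (f : A₀[X]) : Γ f - f ∈ I :=
  sub_mem_of_forall_C (Γ' := RingHom.id _) I hX hC f

end Generators

/-! ## The sigmaNeg `τ : X ↦ −X` -/

section Twist

/-- The `A₀`-algebra involution `τ : σ ↦ −σ` of `A₀[σ]` (construction, ours).
[cite: SerreLocalFields1979, Ch. II §4 Lemma 1] -/
noncomputable def sigmaNeg : A₀[X] →ₐ[A₀] A₀[X] := aeval (-X)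

/-- Unfolding `τ` (plumbing). [cite: SerreLocalFields1979, Ch. II §4 Lemma 1] -/
theorem sigmaNeg_apply (f : A₀[X]) : sigmaNeg f = aeval (-X) f := rfl

/-- `τ(σ) = −σ` (plumbing). [cite: SerreLocalFields1979, Ch. II §4 Lemma 1] -/
@[simp] theorem sigmaNeg_X : sigmaNeg (X : A₀[X]) = -X := by
  rw [sigmaNeg_apply, aeval_X]

/-- `τ` fixes the constants (plumbing). [cite: SerreLocalFields1979, Ch. II §4 Lemma 1] -/
@[simp] theorem sigmaNeg_C (a : A₀) : sigmaNeg (C a) = C a := by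
  rw [sigmaNeg_apply, aeval_C, Polynomial.algebraMap_eq]

/-- `τ² = id` (derived here). [cite: SerreLocalFields1979, Ch. II §4 Lemma 1] -/
@[simp] theorem sigmaNeg_sigmaNeg (f : A₀[X]) : sigmaNeg (sigmaNeg f) = f := by
  have h : ((sigmaNeg (A₀ := A₀)).comp sigmaNeg : A₀[X] →ₐ[A₀] A₀[X]) = AlgHom.id A₀ A₀[X] :=
    Polynomial.algHom_ext (by simp)
  exact DFunLike.congr_fun h f

/-- `τ ≡ id (mod X)` (derived here). [cite: SerreLocalFields1979, Ch. II §4 Lemma 1] -/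
theorem sigmaNeg_sub_self_mem (f : A₀[X]) : sigmaNeg f - f ∈ Ideal.span {(X : A₀[X])} := by
  refine sub_self_mem_of_forall_C (sigmaNeg (A₀ := A₀)).toRingHom _ ?_ (fun a => ?_) f
  · show sigmaNeg (X : A₀[X]) - X ∈ _
    rw [sigmaNeg_X]
    exact Ideal.mem_span_singleton'.2 ⟨-2, by ring⟩
  · show sigmaNeg (C a) - C a ∈ _
    rw [sigmaNeg_C, sub_self]
    exact zero_mem _

/-- `τ` preserves the ideals `(Xⁿ)` (derived here). [cite: SerreLocalFields1979, Ch. II §4 Lemma 1] -/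
theorem sigmaNeg_mem_span_X_pow {f : A₀[X]} {n : ℕ} (h : f ∈ Ideal.span {(X : A₀[X]) ^ n}) :
    sigmaNeg f ∈ Ideal.span {(X : A₀[X]) ^ n} := by
  obtain ⟨v, rfl⟩ := Ideal.mem_span_singleton'.1 h
  rw [map_mul, map_pow, sigmaNeg_X, neg_pow]
  exact Ideal.mem_span_singleton'.2 ⟨sigmaNeg v * (-1) ^ n, by ring⟩

end Twist

/-! ## The twisted isotropy `Φ_{−σ} = τ ∘ Φ ∘ τ` and `Γ_σ = Φ_σ ∘ Φ_{−σ}` -/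

section Conj

/-- `Φ_{−σ} := τ ∘ Φ ∘ τ` (construction, ours). [cite: SerreLocalFields1979, Ch. II §4 Lemma 1] -/
noncomputable def twistConj (Φ : A₀[X] →+* A₀[X]) : A₀[X] →+* A₀[X] :=
  (sigmaNeg (A₀ := A₀)).toRingHom.comp (Φ.comp (sigmaNeg (A₀ := A₀)).toRingHom)

/-- Unfolding `Φ_{−σ}` (plumbing). [cite: SerreLocalFields1979, Ch. II §4 Lemma 1] -/
theorem twistConj_apply (Φ : A₀[X] →+* A₀[X]) (f : A₀[X]) : twistConj Φ f = sigmaNeg (Φ (sigmaNeg f)) := rfl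

/-- `Φ_{−σ}(σ) = σ` (plumbing). [cite: SerreLocalFields1979, Ch. II §4 Lemma 1] -/
theorem twistConj_X (Φ : A₀[X] →+* A₀[X]) (hX : Φ X = X) : twistConj Φ X = X := by
  rw [twistConj_apply, sigmaNeg_X, map_neg, hX, map_neg, sigmaNeg_X, neg_neg]

/-- `Φ_{−σ}` on constants (plumbing). [cite: SerreLocalFields1979, Ch. II §4 Lemma 1] -/
theorem twistConj_C (Φ : A₀[X] →+* A₀[X]) (a : A₀) : twistConj Φ (C a) = sigmaNeg (Φ (C a)) := by
  rw [twistConj_apply, sigmaNeg_C]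

/-- `Φ ↦ Φ_{−σ}` is an involution (derived here). [cite: SerreLocalFields1979, Ch. II §4 Lemma 1] -/
@[simp] theorem twistConj_twistConj (Φ : A₀[X] →+* A₀[X]) : twistConj (twistConj Φ) = Φ :=
  RingHom.ext fun f => by simp [twistConj_apply]

/-- … and multiplicative (derived here). [cite: SerreLocalFields1979, Ch. II §4 Lemma 1] -/
theorem twistConj_comp (Φ Ψ : A₀[X] →+* A₀[X]) : twistConj (Φ.comp Ψ) = (twistConj Φ).comp (twistConj Ψ) :=
  RingHom.ext fun f => by simp [twistConj_apply]

/-- `id_{−σ} = id` (plumbing). [cite: SerreLocalFields1979, Ch. II §4 Lemma 1] -/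
@[simp] theorem twistConj_id : twistConj (RingHom.id A₀[X]) = RingHom.id A₀[X] :=
  RingHom.ext fun f => by simp [twistConj_apply]

/-- `Φ ≡ id (mod X)` ⇒ `Φ_{−σ} ≡ id (mod X)` (derived here). [cite: SerreLocalFields1979, Ch. II §4 Lemma 1] -/
theorem twistConj_sub_self_mem_span_X (Φ : A₀[X] →+* A₀[X]) (hX : Φ X = X)
    (hΦ : ∀ a, Φ (C a) - C a ∈ Ideal.span {(X : A₀[X])}) (f : A₀[X]) :
    twistConj Φ f - f ∈ Ideal.span {(X : A₀[X])} := by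
  have hΦ' := sub_self_mem_of_forall_C Φ _ (by rw [hX, sub_self]; exact zero_mem _) hΦ
  have h : twistConj Φ f - f = sigmaNeg (Φ (sigmaNeg f) - sigmaNeg f) := by
    rw [map_sub, sigmaNeg_sigmaNeg, twistConj_apply]
  rw [h]
  have h1 : Φ (sigmaNeg f) - sigmaNeg f ∈ Ideal.span {(X : A₀[X]) ^ 1} := by simpa using hΦ' (sigmaNeg f)
  simpa using sigmaNeg_mem_span_X_pow h1

/-- "`Φ` is an isotropy of `g ∈ A₀`": `Φ (g) = g` (schematic predicate; the cell's `g ∈ k[ε_N]` has no `σ`).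
[cite: SerreLocalFields1979, Ch. II §4 Lemma 1] -/
def IsIsotropyOf (g : A₀) (Φ : A₀[X] →+* A₀[X]) : Prop := Φ (C g) = C g

/-- Isotropies of `g` are closed under composition (derived here; group-law part of T12 (ii)). [cite: SerreLocalFields1979, Ch. II §4 Lemma 1] -/
theorem IsIsotropyOf.comp {g : A₀} {Φ Ψ : A₀[X] →+* A₀[X]} (hΦ : IsIsotropyOf g Φ) (hΨ : IsIsotropyOf g Ψ) :
    IsIsotropyOf g (Φ.comp Ψ) := by
  unfold IsIsotropyOf at *
  rw [RingHom.comp_apply, hΨ, hΦ]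

/-- … and under the sigmaNeg `Φ ↦ Φ_{−σ}` (derived here). [cite: SerreLocalFields1979, Ch. II §4 Lemma 1] -/
theorem IsIsotropyOf.twistConj {g : A₀} {Φ : A₀[X] →+* A₀[X]} (hΦ : IsIsotropyOf g Φ) :
    IsIsotropyOf g (twistConj Φ) := by
  unfold IsIsotropyOf at *
  rw [twistConj_C, hΦ, sigmaNeg_C]

/-- `Γ_σ := Φ_σ ∘ Φ_{−σ}` (construction, ours). [cite: SerreLocalFields1979, Ch. II §4 Lemma 1] -/
noncomputable def gammaOf (Φ : A₀[X] →+* A₀[X]) : A₀[X] →+* A₀[X] := Φ.comp (twistConj Φ)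

/-- Unfolding `Γ_σ` (plumbing). [cite: SerreLocalFields1979, Ch. II §4 Lemma 1] -/
theorem gammaOf_apply (Φ : A₀[X] →+* A₀[X]) (f : A₀[X]) : gammaOf Φ f = Φ (twistConj Φ f) := rfl

/-- `Γ_σ(σ) = σ` (plumbing). [cite: SerreLocalFields1979, Ch. II §4 Lemma 1] -/
theorem gammaOf_X {Φ : A₀[X] →+* A₀[X]} (hX : Φ X = X) : gammaOf Φ X = X := by
  rw [gammaOf_apply, twistConj_X Φ hX, hX]

/-- `Γ_σ` is again an isotropy of `g` (derived here). [cite: SerreLocalFields1979, Ch. II §4 Lemma 1] -/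
theorem IsIsotropyOf.gammaOf {g : A₀} {Φ : A₀[X] →+* A₀[X]} (hΦ : IsIsotropyOf g Φ) :
    IsIsotropyOf g (gammaOf Φ) :=
  hΦ.comp hΦ.twistConj

/-- `Γ_{−σ} = Φ_{−σ} ∘ Φ_σ` (derived here). [cite: SerreLocalFields1979, Ch. II §4 Lemma 1] -/
theorem twistConj_gammaOf (Φ : A₀[X] →+* A₀[X]) : twistConj (gammaOf Φ) = (twistConj Φ).comp Φ := by
  rw [gammaOf, twistConj_comp, twistConj_twistConj]

/-- **LEMMA Γ (b)**: `Φ X = X` and `Φ ≡ id (mod X)` imply `Γ_σ = Φ ∘ Φ_{−σ} ≡ id (mod X²)` (derived here; the linear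
terms `±X·D` cancel). [cite: SerreLocalFields1979, Ch. II §4 Lemma 1] -/
theorem gammaOf_sub_self_mem {Φ : A₀[X] →+* A₀[X]} (hX : Φ X = X)
    (hΦ : ∀ a, Φ (C a) - C a ∈ Ideal.span {(X : A₀[X])}) (f : A₀[X]) :
    gammaOf Φ f - f ∈ Ideal.span {(X : A₀[X]) ^ 2} := by
  have hΦ' := sub_self_mem_of_forall_C Φ _ (by rw [hX, sub_self]; exact zero_mem _) hΦ
  refine sub_self_mem_of_forall_C (gammaOf Φ) _ ?_ (fun a => ?_) f
  · rw [gammaOf_X hX, sub_self]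
    exact zero_mem _
  · obtain ⟨q, hq⟩ := Ideal.mem_span_singleton'.1 (hΦ a)
    have hΦCa : Φ (C a) = C a + q * X := by rw [hq]; ring
    have h1 : gammaOf Φ (C a) - C a = (q - Φ (sigmaNeg q)) * X := by
      rw [gammaOf_apply, twistConj_C, hΦCa, map_add, sigmaNeg_C, map_mul, sigmaNeg_X, map_add, hΦCa, map_mul,
        map_neg, hX]
      ring
    rw [h1]
    have h2 : q - Φ (sigmaNeg q) ∈ Ideal.span {(X : A₀[X])} := by
      have := sub_mem (neg_mem (sigmaNeg_sub_self_mem q)) (hΦ' (sigmaNeg q))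
      convert this using 1
      ring
    obtain ⟨v, hv⟩ := Ideal.mem_span_singleton'.1 h2
    rw [← hv, mul_assoc, ← pow_two]
    exact Ideal.mul_mem_left _ _ (Ideal.subset_span rfl)

/-- **Parity**: `Γ X = X`, `Γ ≡ id (mod Xⁿ)` with `n` even imply `Γ_{−σ} ≡ Γ (mod Xⁿ⁺¹)` (derived here; `(−X)ⁿ = Xⁿ`
and `τ ≡ id (mod X)`). [cite: SerreLocalFields1979, Ch. II §4 Lemma 1] -/
theorem twistConj_sub_mem_span_pow_succ (Γ : A₀[X] →+* A₀[X]) (hX : Γ X = X) {n : ℕ} (hn : Even n)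
    (hΓ : ∀ a, Γ (C a) - C a ∈ Ideal.span {(X : A₀[X]) ^ n}) (f : A₀[X]) :
    twistConj Γ f - Γ f ∈ Ideal.span {(X : A₀[X]) ^ (n + 1)} := by
  refine sub_mem_of_forall_C _ ?_ (fun a => ?_) f
  · rw [twistConj_X Γ hX, hX, sub_self]
    exact zero_mem _
  · obtain ⟨q, hq⟩ := Ideal.mem_span_singleton'.1 (hΓ a)
    have hΓCa : Γ (C a) = C a + q * X ^ n := by rw [hq]; ring
    have h1 : twistConj Γ (C a) - Γ (C a) = (sigmaNeg q - q) * X ^ n := by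
      rw [twistConj_C, hΓCa, map_add, sigmaNeg_C, map_mul, map_pow, sigmaNeg_X, hn.neg_pow]
      ring
    rw [h1]
    obtain ⟨v, hv⟩ := Ideal.mem_span_singleton'.1 (sigmaNeg_sub_self_mem q)
    rw [← hv, mul_assoc, ← pow_succ']
    exact Ideal.mul_mem_left _ _ (Ideal.subset_span rfl)

/-- `Γ_{−σ} ≡ id (mod X²)` as well (derived here). [cite: SerreLocalFields1979, Ch. II §4 Lemma 1] -/
theorem twistConj_gammaOf_sub_self_mem {Φ : A₀[X] →+* A₀[X]} (hX : Φ X = X)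
    (hΦ : ∀ a, Φ (C a) - C a ∈ Ideal.span {(X : A₀[X])}) (f : A₀[X]) :
    twistConj (gammaOf Φ) f - f ∈ Ideal.span {(X : A₀[X]) ^ 2} := by
  have h := gammaOf_sub_self_mem (Φ := twistConj Φ) (twistConj_X Φ hX)
    (fun a => twistConj_sub_self_mem_span_X Φ hX hΦ (C a)) f
  rwa [gammaOf, twistConj_twistConj, ← twistConj_gammaOf] at h

/-- **`Γ_{−σ} ≡ Γ_σ (mod X³)`** (derived here; parity at `n = 2`). [cite: SerreLocalFields1979, Ch. II §4 Lemma 1] -/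
theorem twistConj_gammaOf_sub_gammaOf_mem {Φ : A₀[X] →+* A₀[X]} (hX : Φ X = X)
    (hΦ : ∀ a, Φ (C a) - C a ∈ Ideal.span {(X : A₀[X])}) (f : A₀[X]) :
    twistConj (gammaOf Φ) f - gammaOf Φ f ∈ Ideal.span {(X : A₀[X]) ^ 3} :=
  twistConj_sub_mem_span_pow_succ (gammaOf Φ) (gammaOf_X hX) even_two
    (fun a => gammaOf_sub_self_mem hX hΦ (C a)) f

end Conj

/-! ## Over a base ring `k`: the `k[X]`-algebra form (hypotheses of `WeightedCentreUnipotentIsotropy`) -/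

section OverBase

variable (k : Type*) [CommRing k] [Algebra k A₀]

-- `Polynomial.algebra : Algebra k[X] A₀[X]` (`X ↦ X`) is Mathlib's own reducible def, deliberately not a global instance
-- (it would create a diamond for `A₀ = k[X]`); Mathlib enables it locally in `RingTheory.PolynomialAlgebra` exactly as here.
-- In the cell `A₀ = k[ε_N]` is an `MvPolynomial`, so no clash arises (see the sanity instance in the packet).
attribute [local instance] Polynomial.algebra

/-- `((Xⁿ) ⊆ k[X])·A₀[X] = (Xⁿ) ⊆ A₀[X]` (plumbing). [cite: SerreLocalFields1979, Ch. II §4 Lemma 1] -/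
theorem map_span_X_pow (n : ℕ) :
    (Ideal.span {(X : k[X]) ^ n}).map (algebraMap k[X] A₀[X]) = Ideal.span {(X : A₀[X]) ^ n} := by
  rw [Ideal.map_span, Set.image_singleton, Polynomial.algebraMap_def, coe_mapRingHom, Polynomial.map_pow, map_X]

/-- A ring endomorphism of `A₀[X]` fixing `X` and the constants of `k` is a `k[X]`-algebra endomorphism
(construction, ours). [cite: SerreLocalFields1979, Ch. II §4 Lemma 1] -/
noncomputable def toPolyAlgHom (Γ : A₀[X] →+* A₀[X]) (hX : Γ X = X)
    (hk : ∀ c : k, Γ (C (algebraMap k A₀ c)) = C (algebraMap k A₀ c)) : A₀[X] →ₐ[k[X]] A₀[X] :=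
  { Γ with
    commutes' := fun q => by
      have h : Γ.comp (algebraMap k[X] A₀[X]) = algebraMap k[X] A₀[X] := by
        apply Polynomial.ringHom_ext
        · intro c
          rw [RingHom.comp_apply, Polynomial.algebraMap_def, coe_mapRingHom, map_C, hk]
        · rw [RingHom.comp_apply, Polynomial.algebraMap_def, coe_mapRingHom, map_X, hX]
      exact DFunLike.congr_fun h q }

/-- The upgrade does not change the map (plumbing). [cite: SerreLocalFields1979, Ch. II §4 Lemma 1] -/
@[simp] theorem coe_toPolyAlgHom (Γ : A₀[X] →+* A₀[X]) (hX : Γ X = X)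
    (hk : ∀ c : k, Γ (C (algebraMap k A₀ c)) = C (algebraMap k A₀ c)) : ⇑(toPolyAlgHom k Γ hX hk) = Γ := rfl

variable {k}

/-- For a `k`-algebra endomorphism `Φ` of `A₀[X]`, `Γ_σ` fixes the constants of `k` (plumbing).
[cite: SerreLocalFields1979, Ch. II §4 Lemma 1] -/
theorem gammaOf_C_algebraMap (Φ : A₀[X] →ₐ[k] A₀[X]) (c : k) :
    gammaOf (Φ : A₀[X] →+* A₀[X]) (C (algebraMap k A₀ c)) = C (algebraMap k A₀ c) := by
  have hc : C (algebraMap k A₀ c) = algebraMap k A₀[X] c := (Polynomial.algebraMap_apply c).symm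
  rw [gammaOf_apply, twistConj_C, RingHom.coe_coe, hc, AlgHom.commutes, ← hc, sigmaNeg_C, hc, AlgHom.commutes]

/-- … and so does `Γ_{−σ}` (plumbing). [cite: SerreLocalFields1979, Ch. II §4 Lemma 1] -/
theorem twistConj_gammaOf_C_algebraMap (Φ : A₀[X] →ₐ[k] A₀[X]) (c : k) :
    twistConj (gammaOf (Φ : A₀[X] →+* A₀[X])) (C (algebraMap k A₀ c)) = C (algebraMap k A₀ c) := by
  rw [twistConj_C, gammaOf_C_algebraMap, sigmaNeg_C]

/-- `hΓ` of the companion file: `Γ_σ a − a ∈ ((X²) ⊆ k[X])·A₀[X]` (derived here).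
[cite: SerreLocalFields1979, Ch. II §4 Lemma 1] -/
theorem gammaOf_sub_self_mem_map (Φ : A₀[X] →ₐ[k] A₀[X]) (hX : Φ X = X)
    (hΦ : ∀ a, Φ (C a) - C a ∈ Ideal.span {(X : A₀[X])}) (f : A₀[X]) :
    gammaOf (Φ : A₀[X] →+* A₀[X]) f - f ∈ (Ideal.span {(X : k[X]) ^ 2}).map (algebraMap k[X] A₀[X]) := by
  rw [map_span_X_pow]
  exact gammaOf_sub_self_mem (Φ := (Φ : A₀[X] →+* A₀[X])) hX hΦ f

/-- `hΓ'` of the companion file: `Γ_{−σ} a − a ∈ ((X²) ⊆ k[X])·A₀[X]` (derived here).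
[cite: SerreLocalFields1979, Ch. II §4 Lemma 1] -/
theorem twistConj_gammaOf_sub_self_mem_map (Φ : A₀[X] →ₐ[k] A₀[X]) (hX : Φ X = X)
    (hΦ : ∀ a, Φ (C a) - C a ∈ Ideal.span {(X : A₀[X])}) (f : A₀[X]) :
    twistConj (gammaOf (Φ : A₀[X] →+* A₀[X])) f - f
      ∈ (Ideal.span {(X : k[X]) ^ 2}).map (algebraMap k[X] A₀[X]) := by
  rw [map_span_X_pow]
  exact twistConj_gammaOf_sub_self_mem (Φ := (Φ : A₀[X] →+* A₀[X])) hX hΦ f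

/-- `hd` of the companion file: `Γ_{−σ} a − Γ_σ a ∈ ((X³) ⊆ k[X])·A₀[X]` (derived here).
[cite: SerreLocalFields1979, Ch. II §4 Lemma 1] -/
theorem twistConj_gammaOf_sub_gammaOf_mem_map (Φ : A₀[X] →ₐ[k] A₀[X]) (hX : Φ X = X)
    (hΦ : ∀ a, Φ (C a) - C a ∈ Ideal.span {(X : A₀[X])}) (f : A₀[X]) :
    twistConj (gammaOf (Φ : A₀[X] →+* A₀[X])) f - gammaOf (Φ : A₀[X] →+* A₀[X]) f
      ∈ (Ideal.span {(X : k[X]) ^ 3}).map (algebraMap k[X] A₀[X]) := by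
  rw [map_span_X_pow]
  exact twistConj_gammaOf_sub_gammaOf_mem (Φ := (Φ : A₀[X] →+* A₀[X])) hX hΦ f

end OverBase

end Literature.AlgebraicGeometry.Resolution.WeightedBlowup
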